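import Literature.MathematicalPhysics.QuantumFieldTheory.Balaban1983to89.B9Eq342GreenPrimeSupBoundDecay
import Literature.MathematicalPhysics.QuantumFieldTheory.Balaban1983to89.B5Eq129FreeResolventDecayedLetterSite

/-!
# `Balaban1983to89.B9Eq342GreenPrimeSupBoundDecayCosh` — T. Bałaban, *Propagators for lattice gauge theories in a background field*, Commun. Math. Phys.
# **99** (1985) 389–434 [Balaban1985BackgroundPropagators] Thm 3.1 (3.42) p. 397, FIRST ENTRY WITH ITS DECAY FACTOR, FOR PRINT's `G′(U)`, **WITH THE
# WEIGHT (W) AND THE DECAYED FREE LETTER (D-FS) INHABITED** by the Agmon `cosh` weight centred at the output site (`B9Eq342CoshWeightSite`,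
# `B5Eq129FreeResolventDecayedLetterSite`): `‖(G′(U)f)(x₀)‖ ≤ (B₁ + B₂)·K_d(κ′∕2)·sup|f|` for EVERY `f`, and `≤ (B₁+B₂)e^{−(κ′∕2)d_m(πx₀,v)}·sup|f|` for
# `supp f ⊂ B(v)`, with `B₁ = (1 + p₂C_E√μ)·2e^{a(L−1)}·Σ_{l<k}λ^{−(l+1)}`, `B₂ = √(λ^{−k}∕c₀)·√(2e^{a(L−1)}K_d(aL−κ′))·C_E·√μ`,
# `λ = 1 − 2d·η⁻²(cosh a − 1) > 0` — EVERY CONSTANT VOLUME-FREE AS DISPLAYED; the THREE remaining displayed letters are the chain's: (T)∕unitarity, the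
# block-local penalty (D-P) and the `L²` block decay (D-E)** — storey (D) of the NE9 owner's SUP-NORM PROGRAMME (plan v10 §5), the (D-A) assembly composed
# with its two [folklore] inhabitants

statement-level skeleton of published theorems with citation tags; proofs where landed; nothing here is a claim about the Yang–Mills mass gap

CITATION HEADER (lean-in-tree rule).  Audit cell `pub-balaban`, sub-cell `t4`, BINDER row NE9; filed by the row OWNER lineage `b2b-balaban-t4-ne9-p1` (gen 90).
Sources as quoted verbatim in `B9Eq342GreenPrimeSupBoundDecay` ([Balaban1985BackgroundPropagators] p. 397 Thm 3.1 (3.42) *«… ≤ B₀e^{−δ₀d(y,y′)} for x ∈ Δ(y),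
y ∈ Λ_j, supp λ ⊂ Δ(y′)»*, (3.23)–(3.25) p. 394, (3.49) p. 399; print's random-walk proof pp. 415–426 NOT reproduced).  NOTHING printed is used as a
hypothesis; `[cite: …]` tags are TEXT LOCATIONS; every statement is `[folklore]` composition BY NAME (ABSOLUTE RULE).

WHAT IS PROVED (sorry-free; 0 `def`).  Data of `B9Eq342GreenPrimeSupBoundDecay` §2 with the weight letters (W) := `B9Eq342CoshWeightSite.weight_site_letters`
and (D-FS) := `B5Eq129FreeResolventDecayedLetterSite.hDFS_cosh_site'` (the `Tor`-free constant `√(λ^{−k}∕c₀)` — crude `ḡ_k ≤ 1`; rate `0 ≤ a`,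
`0 < λ = 1 − 2d·η⁻²(cosh a − 1)`, `0 < κ′ ≤ κ`, `κ′ < aL`):
* §3 `norm_covGrad_GpOfU_apply_le_rowSum_cosh` — (3.42)'s SECOND entry at the top level, TRIVIALLY: `‖(∇_U G′(U)f)(x₀,μ)‖ ≤ 2|η|⁻¹·(B₁+B₂)K_d·F` (honest:
  `η⁻¹ = L` here; NOT the height-free ∇-row of the tower).
* §0 `rate_explicit` — the rate `a⋆ = √(m∕(4dt²+m))`: `λ ≥ m∕2` AND `a⋆·t ≥ √(m∕(4d+m))` (the block rate `κ₁ = a⋆t` is HEIGHT-FREE at `t = L^{n+1}`).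
* **`norm_GpOfU_apply_le_decay_cosh`** (one-block source, decay `e^{−(κ′∕2)d_m(πx₀,v)}`); **`norm_GpOfU_apply_le_rowSum_cosh`** (every `f`, row sum
  `K_d(κ′∕2)`); **`norm_GpOfU_apply_le_rowSum_cosh_unitary`** ((T) inhabited on the chain's class: unitary `U`, `*`-trace, compatible fibre norm).
REMAINING LETTERS (displayed): (D-P) `‖((Δ′_{a′}(U) − Δ^η_U)v)(x)‖ ≤ p₂‖P_{πx}v‖` (ne9-leaf-03's `B9Eq324PenaltyBlockLocal`, `p₂ = |a′|∕√c₁`); (D-E)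
`‖P_y∘G′(U)∘P_v‖ ≤ C_E·e^{−κd_m(v,y)}` (`B9Eq349ConjugatedGreenBlockDecay.exists_block_decay_Gp` on its window, `C_E = (4∕γ)e^{r}`, `κ = r`); one-block
masses `‖P_vf‖ ≤ √μ·F` (`μ = c₀L^d`).  (The sharper level-free `ḡ_k∕c₀ ≤ 3^d∕c₁` for `k ≥ d` is ne9-leaf-02's `…ZoneSumLetters.entry_const_diag_le` — matters
for the TOWER twin, not at the top level where `1∕c₀` is a function of `L`.)
HONEST SCOPE.  Composition; VALUE row only — no ∇-row, no Hölder norms; constants crude.  NOT summit progress (cell pub-balaban: NE9 NOT PRINTED ∕ NOT PROVED;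
«NE9 ⇐ the named binders»; row WALLED ON A MODEL (O-NE9-1; #5 UNRULED); spine PROVED 0∕9; rung (B)+1 finite T⁴ — NOT infinite volume, NOT mass gap, NOT
BetaPertH, NOT Clay).  HONEST DEPENDENCY (cell line): continuum YM on T⁴ ⇐ BetaPertH ∧ nine spine estimates (0/9 proved); BetaPertH ⇐ (D1) ∧ (D4) ∧ CAP+tail;
G-an2-4 gates asym, D1 and NE2/3/4.  NEW file importing `B9Eq342GreenPrimeSupBoundDecay` + `B5Eq129FreeResolventDecayedLetterSite`; nothing modified.  Net
new unproved facts: 0.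
-/

noncomputable section

open scoped InnerProductSpace ComplexConjugate BigOperators

namespace Literature.MathematicalPhysics.QuantumFieldTheory.Balaban1983to89.B9Eq342GreenPrimeSupBoundDecayCosh

open B4Sect5Torus (TSite tdist)
open B4Sect5Proof (latticeConst)
open B9SectCLatticeCarrier (Bond shift unshift)
open B9Eq319QprimeTorus (fineP blockCoord)
open B9Eq311L2Pairing (WL2)
open B11Eq103H1Complex (SiteL2K covLaplaceSiteK)
open B9Eq310HessianOperator (adTransportW)
open B9Eq3119DeltaPiCarrier (laplacePrimeA GpOfU)
open B9Eq342GreenPrimeSupBound (norm_adTransportW_eq norm_adTransportW_inv_eq)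
open B9Eq342GreenPrimeSupBoundDecay (norm_GpOfU_apply_le_decay' norm_GpOfU_apply_le_rowSum)
open B9Eq342CoshWeightSite (weight_site_letters neZero_fineP)
open B5Eq129FreeResolventDecayedLetterSite (hDFS_cosh_site')

variable {d : ℕ} (L : ℕ) [NeZero L] (m : Fin d → ℕ) {𝔸 : Type*} [Ring 𝔸] [StarRing 𝔸] [Algebra ℂ 𝔸] [StarModule ℂ 𝔸]
  {W : Type*} [NormedAddCommGroup W] [InnerProductSpace ℂ W] [FiniteDimensional ℂ W] (φ : W ≃ₗ[ℂ] 𝔸) {c₀ : ℝ} [Fact (0 < c₀)]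
  (η : ℝ) (U : Bond d (fineP L m) → 𝔸ˣ) {c₁ : ℝ} [Fact (0 < c₁)] (a' : ℝ)
  (hpos' : ∀ x : SiteL2K ℂ d (fineP L m) c₀ W, x ≠ 0 → 0 < RCLike.re ⟪x, laplacePrimeA L m φ η U a' (c₁ := c₁) x⟫_ℂ)

/-! ## §0 Rate bookkeeping: an explicit rate whose BLOCK rate `a·t` is height-free -/

/-- `cosh a − 1 ≤ a²` on `[0,1]` (private twin of `B9Eq342CoshWeightSite`'s helper). [folklore] -/
private theorem cosh_sub_one_le_sq' {a : ℝ} (ha0 : 0 ≤ a) (ha1 : a ≤ 1) : Real.cosh a - 1 ≤ a ^ 2 := by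
  have h1 : Real.cosh a ≤ Real.exp (a ^ 2 / 2) := Real.cosh_le_exp_half_sq a
  have hs : |a ^ 2 / 2| ≤ 1 := by
    rw [abs_of_nonneg (by positivity)]
    nlinarith
  have h2 : |Real.exp (a ^ 2 / 2) - 1| ≤ 2 * |a ^ 2 / 2| := Real.abs_exp_sub_one_le hs
  rw [abs_of_nonneg (by positivity : (0 : ℝ) ≤ a ^ 2 / 2)] at h2
  have h3 := (le_abs_self _).trans h2
  linarith

/-- **AN EXPLICIT RATE WITH A HEIGHT-FREE BLOCK RATE**: for `0 < m`, `1 ≤ t` the rate `a⋆ = √(m∕(4d·t² + m))` satisfies `0 < a⋆ ≤ 1`,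
`m∕2 ≤ m − 2d·t²(cosh a⋆ − 1)` (so `λ ≥ m∕2`) AND `√(m∕(4d + m)) ≤ a⋆·t` — read at the chain's letters (`t = η⁻¹ = L^{n+1}` at height `n+1`, `m = 1`) the
block-distance rate `κ₁ = a⋆·L^{n+1}` of the weight letter `hWd` is bounded BELOW by `1∕√(4d+1)` and the matching factor `M = 2e^{a⋆(L^{n+1}−1)} ≤ 2e`, BOTH FREE OF
THE HEIGHT — the form in which print's «δ₀, B₀ dependent on d and L only» survives the tower (sharper than `B9Eq342CoshWeightSite.exists_rate`, whose witness
`a ∝ t⁻²` is enough at one step). [folklore] [cite: Balaban1985BackgroundPropagators, Thm 3.1 p.397; Balaban1984PropagatorsI, p.36] -/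
theorem rate_explicit (t m : ℝ) (hm : 0 < m) (ht : 1 ≤ t) :
    0 < Real.sqrt (m / (4 * d * t ^ 2 + m)) ∧ Real.sqrt (m / (4 * d * t ^ 2 + m)) ≤ 1 ∧
      m / 2 ≤ m - 2 * d * t ^ 2 * (Real.cosh (Real.sqrt (m / (4 * d * t ^ 2 + m))) - 1) ∧
      Real.sqrt (m / (4 * d + m)) ≤ Real.sqrt (m / (4 * d * t ^ 2 + m)) * t := by
  have hD : 0 < 4 * (d : ℝ) * t ^ 2 + m := by positivity
  have hq : 0 < m / (4 * d * t ^ 2 + m) := div_pos hm hD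
  have hq1 : m / (4 * d * t ^ 2 + m) ≤ 1 := by rw [div_le_one hD]; nlinarith [sq_nonneg t]
  set a := Real.sqrt (m / (4 * d * t ^ 2 + m)) with ha_def
  have ha0 : 0 < a := Real.sqrt_pos.2 hq
  have ha1 : a ≤ 1 := by rw [ha_def, Real.sqrt_le_one]; exact hq1
  have hsq : a ^ 2 = m / (4 * d * t ^ 2 + m) := Real.sq_sqrt hq.le
  refine ⟨ha0, ha1, ?_, ?_⟩
  · have hc : Real.cosh a - 1 ≤ m / (4 * d * t ^ 2 + m) := (cosh_sub_one_le_sq' ha0.le ha1).trans hsq.le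
    have hdt : 0 ≤ 2 * (d : ℝ) * t ^ 2 := by positivity
    have h1 : 2 * d * t ^ 2 * (Real.cosh a - 1) ≤ 2 * d * t ^ 2 * (m / (4 * d * t ^ 2 + m)) := mul_le_mul_of_nonneg_left hc hdt
    have h2 : 2 * d * t ^ 2 * (m / (4 * d * t ^ 2 + m)) ≤ m / 2 := by
      rw [mul_div_assoc', div_le_div_iff₀ hD two_pos]; nlinarith [hm.le, hdt]
    linarith
  · have ht0 : 0 ≤ t := zero_le_one.trans ht
    have ht2 : 1 ≤ t ^ 2 := by nlinarith
    have hB : 0 < 4 * (d : ℝ) + m := by positivity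
    have e : a * t = Real.sqrt (m / (4 * d * t ^ 2 + m) * t ^ 2) := by
      rw [Real.sqrt_mul hq.le, Real.sqrt_sq ht0]
    rw [e]
    refine Real.sqrt_le_sqrt ?_
    rw [div_mul_eq_mul_div, div_le_div_iff₀ hB hD]
    nlinarith [mul_nonneg (mul_nonneg hm.le hm.le) (sub_nonneg.2 ht2), mul_nonneg hm.le ht0]

omit [StarRing 𝔸] [StarModule ℂ 𝔸] in
/-- **(3.42) FIRST ENTRY WITH DECAY FOR `G′(U)`, ONE-BLOCK SOURCE, (W)+(D-FS) INHABITED BY THE `cosh` WEIGHT**: for `f` supported in `B(v)`,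
`‖f(y)‖ ≤ F`, `‖f‖ ≤ √μF`, any rate `0 ≤ a` with `0 < λ = 1 − 2d·η⁻²(cosh a − 1)`, `0 ≤ κ′ ≤ κ`, `κ′ < aL`:
`‖(G′(U)f)(x₀)‖ ≤ (B₁ + B₂)·e^{−(κ′∕2)d_m(πx₀,v)}·F` — letters (T), (D-P), (D-E) displayed. [cite: Balaban1985BackgroundPropagators, Thm 3.1 (3.42) p.397, (3.24)–(3.25) p.394] -/
theorem norm_GpOfU_apply_le_decay_cosh (hm : ∀ i, 1 ≤ m i)
    (hR : ∀ b w, ‖adTransportW φ U b w‖ ≤ ‖w‖) (hS : ∀ b w, ‖adTransportW φ (fun b => (U b)⁻¹) b w‖ ≤ ‖w‖)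
    {PS : TSite d m → SiteL2K ℂ d (fineP L m) c₀ W →L[ℂ] SiteL2K ℂ d (fineP L m) c₀ W}
    (hPS : ∀ (y : TSite d m) (g : SiteL2K ℂ d (fineP L m) c₀ W) (x : TSite d (fineP L m)),
      WL2.equiv ℂ (fun _ : TSite d (fineP L m) => c₀) W (PS y g) x =
        if blockCoord L m x = y then WL2.equiv ℂ (fun _ : TSite d (fineP L m) => c₀) W g x else 0)
    {p₂ CE κ κ' a : ℝ} (hp₂ : 0 ≤ p₂) (hCE : 0 ≤ CE) (ha : 0 ≤ a) (hlam : 0 < 1 - 2 * d * (η⁻¹) ^ 2 * (Real.cosh a - 1))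
    (hκ' : 0 ≤ κ') (hκ : κ' ≤ κ) (hκ₁ : κ' < a * L)
    (hP : ∀ (v : SiteL2K ℂ d (fineP L m) c₀ W) (x : TSite d (fineP L m)),
      ‖WL2.equiv ℂ _ W (laplacePrimeA L m φ η U a' (c₁ := c₁) v -
        covLaplaceSiteK ((η : ℂ))⁻¹ (adTransportW φ U) (adTransportW φ fun b => (U b)⁻¹) v) x‖ ≤ p₂ * ‖PS (blockCoord L m x) v‖)
    {v : TSite d m}
    (hdec : ∀ y : TSite d m, ‖PS y ∘L LinearMap.toContinuousLinearMap (GpOfU L m φ η U a' hpos') ∘L PS v‖ ≤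
      CE * Real.exp (-(κ * tdist m v y)))
    (x₀ : TSite d (fineP L m)) (k : ℕ) (f : SiteL2K ℂ d (fineP L m) c₀ W) (hfv : ∀ x, blockCoord L m x ≠ v → WL2.equiv ℂ _ W f x = 0)
    {F μ : ℝ} (hF : ∀ y, ‖WL2.equiv ℂ _ W f y‖ ≤ F) (hμ : ‖f‖ ≤ Real.sqrt μ * F) :
    ‖WL2.equiv ℂ _ W (GpOfU L m φ η U a' hpos' f) x₀‖ ≤
      ((1 + p₂ * CE * Real.sqrt μ) * (Real.exp (a * ((L : ℝ) - 1)) * 2) *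
            (∑ l ∈ Finset.range k, ((1 - 2 * d * (η⁻¹) ^ 2 * (Real.cosh a - 1)) ^ (l + 1))⁻¹) +
        Real.sqrt (((1 - 2 * d * (η⁻¹) ^ 2 * (Real.cosh a - 1)) ^ k)⁻¹ / c₀) *
          Real.sqrt ((Real.exp (a * ((L : ℝ) - 1)) * 2) * latticeConst d (a * L - κ')) * CE * Real.sqrt μ) *
        Real.exp (-(κ' / 2 * tdist m (blockCoord L m x₀) v)) * F := by
  haveI := neZero_fineP L m hm
  obtain ⟨hW0, hx₀, hsup, hWd⟩ := weight_site_letters L m hm η ha x₀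
  exact norm_GpOfU_apply_le_decay' L m φ η U a' hpos' (c₁ := c₁) hm hR hS hPS hp₂ hCE (Real.sqrt_nonneg _) (by positivity) hlam hκ' hκ hκ₁ hP
    hdec hW0 hx₀ hsup hWd (hDFS_cosh_site' (fineP L m) a η (Fact.out : 0 < c₀) hlam k x₀) f hfv hF hμ

omit [StarRing 𝔸] [StarModule ℂ 𝔸] in
/-- **THE ROW SUM OF (3.42) FOR `G′(U)`, (W)+(D-FS) INHABITED**: for EVERY `f` with `‖f(x)‖ ≤ F` and one-block masses `‖P_vf‖ ≤ √μF`, (D-E) for every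
source block, `0 < κ′ ≤ κ`, `κ′ < aL`, `0 < λ`: `‖(G′(U)f)(x₀)‖ ≤ (B₁ + B₂)·K_d(κ′∕2)·F` — the `L^∞ → L^∞` bound of `G′(U)` at the output site `x₀`,
VOLUME-FREE, modulo (T), (D-P), (D-E). [cite: Balaban1985BackgroundPropagators, Thm 3.1 (3.42) p.397, (3.39) p.397, (3.49) p.399] -/
theorem norm_GpOfU_apply_le_rowSum_cosh (hm : ∀ i, 1 ≤ m i)
    (hR : ∀ b w, ‖adTransportW φ U b w‖ ≤ ‖w‖) (hS : ∀ b w, ‖adTransportW φ (fun b => (U b)⁻¹) b w‖ ≤ ‖w‖)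
    {PS : TSite d m → SiteL2K ℂ d (fineP L m) c₀ W →L[ℂ] SiteL2K ℂ d (fineP L m) c₀ W}
    (hPS : ∀ (y : TSite d m) (g : SiteL2K ℂ d (fineP L m) c₀ W) (x : TSite d (fineP L m)),
      WL2.equiv ℂ (fun _ : TSite d (fineP L m) => c₀) W (PS y g) x =
        if blockCoord L m x = y then WL2.equiv ℂ (fun _ : TSite d (fineP L m) => c₀) W g x else 0)
    {p₂ CE κ κ' a : ℝ} (hp₂ : 0 ≤ p₂) (hCE : 0 ≤ CE) (ha : 0 ≤ a) (hlam : 0 < 1 - 2 * d * (η⁻¹) ^ 2 * (Real.cosh a - 1))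
    (hκ' : 0 < κ') (hκ : κ' ≤ κ) (hκ₁ : κ' < a * L)
    (hP : ∀ (v : SiteL2K ℂ d (fineP L m) c₀ W) (x : TSite d (fineP L m)),
      ‖WL2.equiv ℂ _ W (laplacePrimeA L m φ η U a' (c₁ := c₁) v -
        covLaplaceSiteK ((η : ℂ))⁻¹ (adTransportW φ U) (adTransportW φ fun b => (U b)⁻¹) v) x‖ ≤ p₂ * ‖PS (blockCoord L m x) v‖)
    (hdec : ∀ v y : TSite d m, ‖PS y ∘L LinearMap.toContinuousLinearMap (GpOfU L m φ η U a' hpos') ∘L PS v‖ ≤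
      CE * Real.exp (-(κ * tdist m v y)))
    (x₀ : TSite d (fineP L m)) (k : ℕ) (f : SiteL2K ℂ d (fineP L m) c₀ W) {F μ : ℝ} (hF : ∀ y, ‖WL2.equiv ℂ _ W f y‖ ≤ F)
    (hμ : ∀ v, ‖PS v f‖ ≤ Real.sqrt μ * F) :
    ‖WL2.equiv ℂ _ W (GpOfU L m φ η U a' hpos' f) x₀‖ ≤
      ((1 + p₂ * CE * Real.sqrt μ) * (Real.exp (a * ((L : ℝ) - 1)) * 2) *
            (∑ l ∈ Finset.range k, ((1 - 2 * d * (η⁻¹) ^ 2 * (Real.cosh a - 1)) ^ (l + 1))⁻¹) +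
        Real.sqrt (((1 - 2 * d * (η⁻¹) ^ 2 * (Real.cosh a - 1)) ^ k)⁻¹ / c₀) *
          Real.sqrt ((Real.exp (a * ((L : ℝ) - 1)) * 2) * latticeConst d (a * L - κ')) * CE * Real.sqrt μ) *
        latticeConst d (κ' / 2) * F := by
  haveI := neZero_fineP L m hm
  obtain ⟨hW0, hx₀, hsup, hWd⟩ := weight_site_letters L m hm η ha x₀
  exact norm_GpOfU_apply_le_rowSum L m φ η U a' hpos' (c₁ := c₁) hm hR hS hPS hp₂ hCE (Real.sqrt_nonneg _) (by positivity) hlam hκ' hκ hκ₁ hP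
    hdec hW0 hx₀ hsup hWd (hDFS_cosh_site' (fineP L m) a η (Fact.out : 0 < c₀) hlam k x₀) f hF hμ

omit [StarModule ℂ 𝔸] in
/-- **… ON THE CHAIN's CLASS, (T) INHABITED** (unitary `U`, `*`-trace, compatible fibre norm — `B9Eq342GreenPrimeSupBound` §0): the same row-sum bound
with the three standing letters `hU`, `hτ₂`, `hφ` in place of the contraction binders; remaining letters (D-P), (D-E).
[cite: Balaban1985BackgroundPropagators, Thm 3.1 (3.42) p.397, (3.39) p.397] -/
theorem norm_GpOfU_apply_le_rowSum_cosh_unitary (hm : ∀ i, 1 ≤ m i) (τ : 𝔸 →ₗ[ℂ] ℂ) (hτ₂ : ∀ X Y : 𝔸, τ (X * Y) = τ (Y * X))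
    (hU : ∀ b, star (U b : 𝔸) = ((U b)⁻¹ : 𝔸ˣ)) (hφ : ∀ X Y : 𝔸, ⟪φ.symm X, φ.symm Y⟫_ℂ = τ (star X * Y))
    {PS : TSite d m → SiteL2K ℂ d (fineP L m) c₀ W →L[ℂ] SiteL2K ℂ d (fineP L m) c₀ W}
    (hPS : ∀ (y : TSite d m) (g : SiteL2K ℂ d (fineP L m) c₀ W) (x : TSite d (fineP L m)),
      WL2.equiv ℂ (fun _ : TSite d (fineP L m) => c₀) W (PS y g) x =
        if blockCoord L m x = y then WL2.equiv ℂ (fun _ : TSite d (fineP L m) => c₀) W g x else 0)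
    {p₂ CE κ κ' a : ℝ} (hp₂ : 0 ≤ p₂) (hCE : 0 ≤ CE) (ha : 0 ≤ a) (hlam : 0 < 1 - 2 * d * (η⁻¹) ^ 2 * (Real.cosh a - 1))
    (hκ' : 0 < κ') (hκ : κ' ≤ κ) (hκ₁ : κ' < a * L)
    (hP : ∀ (v : SiteL2K ℂ d (fineP L m) c₀ W) (x : TSite d (fineP L m)),
      ‖WL2.equiv ℂ _ W (laplacePrimeA L m φ η U a' (c₁ := c₁) v -
        covLaplaceSiteK ((η : ℂ))⁻¹ (adTransportW φ U) (adTransportW φ fun b => (U b)⁻¹) v) x‖ ≤ p₂ * ‖PS (blockCoord L m x) v‖)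
    (hdec : ∀ v y : TSite d m, ‖PS y ∘L LinearMap.toContinuousLinearMap (GpOfU L m φ η U a' hpos') ∘L PS v‖ ≤
      CE * Real.exp (-(κ * tdist m v y)))
    (x₀ : TSite d (fineP L m)) (k : ℕ) (f : SiteL2K ℂ d (fineP L m) c₀ W) {F μ : ℝ} (hF : ∀ y, ‖WL2.equiv ℂ _ W f y‖ ≤ F)
    (hμ : ∀ v, ‖PS v f‖ ≤ Real.sqrt μ * F) :
    ‖WL2.equiv ℂ _ W (GpOfU L m φ η U a' hpos' f) x₀‖ ≤
      ((1 + p₂ * CE * Real.sqrt μ) * (Real.exp (a * ((L : ℝ) - 1)) * 2) *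
            (∑ l ∈ Finset.range k, ((1 - 2 * d * (η⁻¹) ^ 2 * (Real.cosh a - 1)) ^ (l + 1))⁻¹) +
        Real.sqrt (((1 - 2 * d * (η⁻¹) ^ 2 * (Real.cosh a - 1)) ^ k)⁻¹ / c₀) *
          Real.sqrt ((Real.exp (a * ((L : ℝ) - 1)) * 2) * latticeConst d (a * L - κ')) * CE * Real.sqrt μ) *
        latticeConst d (κ' / 2) * F :=
  norm_GpOfU_apply_le_rowSum_cosh L m φ η U a' hpos' hm (fun b w => (norm_adTransportW_eq φ U τ hτ₂ hU hφ b w).le)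
    (fun b w => (norm_adTransportW_inv_eq φ U τ hτ₂ hU hφ b w).le) hPS hp₂ hCE ha hlam hκ' hκ hκ₁ hP hdec x₀ k f hF hμ

/-! ## §3 The TOP-LEVEL gradient row is the value row times `2η⁻¹` (honest bookkeeping: print-shaped at `L^jη = 1`, useless as a tower template) -/

omit [StarRing 𝔸] [StarModule ℂ 𝔸] in
/-- **THE COVARIANT GRADIENT OF `G′(U)f` AT THE TOP LEVEL, TRIVIALLY**: `‖η⁻¹(R(U(x₀,μ))u(x₀+e_μ) − u(x₀))‖ ≤ |η|⁻¹·2·(B₁+B₂)·K_d(κ′∕2)·sup|f|` for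
`u = G′(U)f` — (3.42)'s SECOND entry «|(∇_{L^{−j}}G′(U)λ)(x)| ≤ B₀…» at `L^jη = 1` with the constant `2η⁻¹(B₁+B₂)K_d = 2L·(…)` («dependent on d and L only»),
from the row sum at the two sites `x₀`, `x₀ + e_μ` and the contraction (T).  HONEST: this is NOT the height-free ∇-row the (N)-reading needs on the tower
(there `η⁻¹ = L^{n+1}`); that row wants gradient regularity (print's Hölder theory ∕ the crux-ideation storey J), not positivity.
[cite: Balaban1985BackgroundPropagators, Thm 3.1 (3.42) p.397, (3.3) p.391] -/
theorem norm_covGrad_GpOfU_apply_le_rowSum_cosh (hm : ∀ i, 1 ≤ m i)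
    (hR : ∀ b w, ‖adTransportW φ U b w‖ ≤ ‖w‖) (hS : ∀ b w, ‖adTransportW φ (fun b => (U b)⁻¹) b w‖ ≤ ‖w‖)
    {PS : TSite d m → SiteL2K ℂ d (fineP L m) c₀ W →L[ℂ] SiteL2K ℂ d (fineP L m) c₀ W}
    (hPS : ∀ (y : TSite d m) (g : SiteL2K ℂ d (fineP L m) c₀ W) (x : TSite d (fineP L m)),
      WL2.equiv ℂ (fun _ : TSite d (fineP L m) => c₀) W (PS y g) x =
        if blockCoord L m x = y then WL2.equiv ℂ (fun _ : TSite d (fineP L m) => c₀) W g x else 0)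
    {p₂ CE κ κ' a : ℝ} (hp₂ : 0 ≤ p₂) (hCE : 0 ≤ CE) (ha : 0 ≤ a) (hlam : 0 < 1 - 2 * d * (η⁻¹) ^ 2 * (Real.cosh a - 1))
    (hκ' : 0 < κ') (hκ : κ' ≤ κ) (hκ₁ : κ' < a * L)
    (hP : ∀ (v : SiteL2K ℂ d (fineP L m) c₀ W) (x : TSite d (fineP L m)),
      ‖WL2.equiv ℂ _ W (laplacePrimeA L m φ η U a' (c₁ := c₁) v -
        covLaplaceSiteK ((η : ℂ))⁻¹ (adTransportW φ U) (adTransportW φ fun b => (U b)⁻¹) v) x‖ ≤ p₂ * ‖PS (blockCoord L m x) v‖)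
    (hdec : ∀ v y : TSite d m, ‖PS y ∘L LinearMap.toContinuousLinearMap (GpOfU L m φ η U a' hpos') ∘L PS v‖ ≤
      CE * Real.exp (-(κ * tdist m v y)))
    (x₀ : TSite d (fineP L m)) (μ₀ : Fin d) (k : ℕ) (f : SiteL2K ℂ d (fineP L m) c₀ W) {F μ : ℝ} (hF : ∀ y, ‖WL2.equiv ℂ _ W f y‖ ≤ F)
    (hμ : ∀ v, ‖PS v f‖ ≤ Real.sqrt μ * F) :
    ‖((η : ℂ))⁻¹ • (adTransportW φ U (x₀, μ₀) (WL2.equiv ℂ _ W (GpOfU L m φ η U a' hpos' f) (shift μ₀ x₀)) -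
        WL2.equiv ℂ _ W (GpOfU L m φ η U a' hpos' f) x₀)‖ ≤
      |η|⁻¹ * (2 * (((1 + p₂ * CE * Real.sqrt μ) * (Real.exp (a * ((L : ℝ) - 1)) * 2) *
            (∑ l ∈ Finset.range k, ((1 - 2 * d * (η⁻¹) ^ 2 * (Real.cosh a - 1)) ^ (l + 1))⁻¹) +
        Real.sqrt (((1 - 2 * d * (η⁻¹) ^ 2 * (Real.cosh a - 1)) ^ k)⁻¹ / c₀) *
          Real.sqrt ((Real.exp (a * ((L : ℝ) - 1)) * 2) * latticeConst d (a * L - κ')) * CE * Real.sqrt μ) *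
        latticeConst d (κ' / 2) * F)) := by
  have h0 := norm_GpOfU_apply_le_rowSum_cosh L m φ η U a' hpos' (c₁ := c₁) hm hR hS hPS hp₂ hCE ha hlam hκ' hκ hκ₁ hP hdec x₀ k f hF hμ
  have h1 := norm_GpOfU_apply_le_rowSum_cosh L m φ η U a' hpos' (c₁ := c₁) hm hR hS hPS hp₂ hCE ha hlam hκ' hκ hκ₁ hP hdec (shift μ₀ x₀) k f
    hF hμ
  rw [norm_smul, norm_inv, Complex.norm_real, Real.norm_eq_abs]
  refine mul_le_mul_of_nonneg_left ?_ (inv_nonneg.2 (abs_nonneg η))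
  calc _ ≤ ‖adTransportW φ U (x₀, μ₀) (WL2.equiv ℂ _ W (GpOfU L m φ η U a' hpos' f) (shift μ₀ x₀))‖ +
        ‖WL2.equiv ℂ _ W (GpOfU L m φ η U a' hpos' f) x₀‖ := norm_sub_le _ _
    _ ≤ ‖WL2.equiv ℂ _ W (GpOfU L m φ η U a' hpos' f) (shift μ₀ x₀)‖ + ‖WL2.equiv ℂ _ W (GpOfU L m φ η U a' hpos' f) x₀‖ :=
        add_le_add (hR _ _) le_rfl
    _ ≤ _ := by linarith [h0, h1]

end Literature.MathematicalPhysics.QuantumFieldTheory.Balaban1983to89.B9Eq342GreenPrimeSupBoundDecayCosh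

end
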